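import Mathlib.NumberTheory.Padics.Complex
import Mathlib.NumberTheory.NumberField.CMField
import Mathlib.NumberTheory.NumberField.InfinitePlace.TotallyRealComplex
import Mathlib.AlgebraicGeometry.EllipticCurve.Affine.Point
import Literature.NumberTheory.Automorphic.AutomorphicRepsGL
import Literature.NumberTheory.Automorphic.ArchimedeanGLn
import Literature.NumberTheory.Automorphic.AdelicGLnGlue
import Literature.NumberTheory.Automorphic.HarishChandraGL
import Literature.NumberTheory.GaloisRepresentations.GaloisRep
import Literature.NumberTheory.GaloisRepresentations.PAdicHodge
import Literature.NumberTheory.GaloisRepresentations.IntegralGaloisAction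
import Literature.NumberTheory.GaloisRepresentations.ContinuousRep
import Literature.NumberTheory.Automorphic.SatakeParametersGL
import Literature.NumberTheory.Automorphic.InfinityType
import Literature.NumberTheory.EllipticCurves.Isogeny
import Mathlib
import HarnessLib

-- provenance: harness21/H21/H21/Statements/Lang/ReciprocityGLn.lean @ 0b08341 (interim HEAD d8f2665); M5 mechanical rewrite
/-!
# Global reciprocity for `GL_n`: Galois representations attached to automorphic representations

Trunk: AutomorphicL, family `lang` (statement item `LangReciprocityGLn`, OUTLINE §3; review 13).
Statements **lang.S27** (Harris–Lan–Taylor–Thorne / Scholze / Varma), **lang.S03**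
(Fontaine–Mazur–Langlands for `GL_n`) and **lang.S28** (potential modularity of elliptic curves
over CM fields, ACC+GHLNSTT). The reciprocity conjecture `R1` for `GL_n` (inventory id lang.S02,
Clozel / Buzzard–Gee) is *not* stated in this file (D-0009; it is the summit statement and lives
problem-side); the design notes below only record why its Hodge–Tate clause cannot yet be phrased.

Let `K` be a number field, `π = W / W'` a cuspidal automorphic representation of `GL_n(𝔸_K)`
(accepted `CuspidalAutomorphicRepData n K`, with its adelic Satake parameters
`π.1.HasSatakeParamAt v α` and Clozel's algebraicity predicates `IsRegularAlgebraic`,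
`IsLAlgebraic`, `HasWeightZero`), `ℓ` a prime and `ι : ℚ̄_ℓ ≃+* ℂ` (with `ℚ̄_ℓ = PadicAlgCl ℓ`,
Mathlib). The Galois side is the accepted G09 API: framed continuous representations
`FramedGaloisRep K A n = Γ_K →ₜ* GL_n(A)`, `IsUnramifiedAt`, `HasFrobCharpolyAt` (arithmetic
Frobenius, `charpoly = det(X - F)`), `ContinuousRep.IsSemisimple`/`IsIrreducible` (Mathlib's
`Representation.IsSemisimpleRepresentation`/`IsIrreducible`) and `GaloisRep.IsGeometric 𝔅`
(Fontaine–Mazur, relative to period-ring data `𝔅` at `v ∣ ℓ`).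

## Helper definitions

* `Lang.numPointsResidue E v = #E(k_v)` (points of the reduction of an integral Weierstrass model
  modulo `v`, including the point at infinity: Mathlib's `WeierstrassCurve.Affine.Point` has the
  constructor `zero`), `Lang.frobTraceAt E v = q_v + 1 - #E(k_v)` (the pattern of the accepted
  BSD `Wave0` Hasse bound). Mathlib *does* have reduction of Weierstrass curves over a DVR
  (`WeierstrassCurve.reduction`, `HasGoodReduction`, `minimal`, `IsIntegral` in
  `Mathlib/AlgebraicGeometry/EllipticCurve/Reduction.lean`) and the local Euler factor
  `WeierstrassCurve.localPolynomial` (`…/EllipticCurve/LFunction.lean`, good-reduction branch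
  `1 - a T + q T²` with `a = q + 1 - Nat.card (W.reduction R).toAffine.Point`), but exposes no
  standalone trace `a_v` (grep `traceOfFrobenius|frobeniusTrace|numPoints`: nothing). We use the
  elementary integral-model helper (reduce the given `𝓞 K`-model modulo `v.asIdeal`) rather than
  `localPolynomial` over `v.adicCompletionIntegers K`, to avoid the `adicCompletion` valuation
  instances; at the cofinitely many places of good reduction of the model the two agree. The
  other accepted formulation of **lang.S28**, `Lang.exists_isCMField_isModular`
  (`H21/Statements/Lang/Sweep1.lean`), reads the trace off Mathlib's `localPolynomial`.
* `Lang.HasQlModel r E rE`: `r : Γ_K → GL_n(ℚ̄_ℓ)` is conjugate to the extension of scalars of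
  `rE : Γ_K → GL_n(E)`, `E ⊆ ℚ̄_ℓ` an intermediate field over `ℚ_ℓ`;
  `Lang.restrictScalarsQl rE : GaloisRep K ℚ_[ℓ] (Fin n → E)`, the `ℚ_ℓ`-linear representation
  underlying `rE`, to which G09's `IsGeometric` (a `ℚ_ℓ`-linear notion, Fontaine) applies.
* `Lang.arithFrobPolyOfSatake ι q m α = ∏_j (X - ι⁻¹((q^{(m-1)/2} α_j)⁻¹))`, the predicted
  characteristic polynomial of an **arithmetic** Frobenius.

## Frobenius convention (review 13)

G09's `HasFrobCharpolyAt v P` says that every *arithmetic* Frobenius `σ` at every `𝔓 ∣ v` has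
`det(X - r σ) = P`. Harris–Lan–Taylor–Thorne's polynomial (accepted `HasHeckePolynomialAt`, G19
`heckePolynomial`) is the characteristic polynomial of the *geometric* Frobenius, with roots
`q_v^{(n-1)/2} α_j` (`rec` sends uniformizers to geometric Frobenii and `r ↔ π ⊗ |det|^{(1-n)/2}`).
Hence the arithmetic Frobenius has the inverse roots `(q_v^{(n-1)/2} α_j)⁻¹`, and the statements
below use `arithFrobPolyOfSatake ι q_v n α`, **not** `P.map ι.symm`. For an L-algebraic `π`
(Buzzard–Gee's normalisation, no half-twist) the roots are `α_j⁻¹`, i.e. `m = 1`. Satake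
parameters of automorphic representations are non-zero (`e_n(α) = ∏ α_j` is the eigenvalue of
the invertible operator `T_{v,n} =` translation by the central element `ϖ · 1`; G19
`IsSatakeParameter.forall_ne_zero`, here `hasSatakeParamAt_ne_zero`), so no junk inverse `0⁻¹`
occurs in the statements.

## Design notes

* Hodge–Tate weights for lang.S02 (`R1`, not stated here) would have to be *omitted*: G09's `IsGeometric 𝔅` exposes, at `v ∣ ℓ`,
  only the unlabelled multiset `𝔅.hodgeTateWeights` of the `ℚ_ℓ`-linear restriction over `K_v`,
  not weights labelled by embeddings `K ↪ ℚ̄_ℓ`, so Buzzard–Gee's prediction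
  `HT_σ(r) = T.hodgeTateWeights σ` (G19 `InfinityType.hodgeTateWeights`) cannot be phrased
  faithfully; the de Rham condition at `v ∣ ℓ` (part of `IsGeometric`) is kept. Likewise
  local-global compatibility at the ramified places and at `v ∣ ℓ` (`WD(r|_{Γ_{K_v}})^{F-ss} ≅
  ι⁻¹ rec(π_v)`, Weil–Deligne representations) is *omitted* from **lang.S27** and
  **lang.S03**: only the unramified compatibility at `v ∤ ℓ` (which determines `r` up to
  semisimplification, Chebotarev + Brauer–Nesbitt) is stated.
* **lang.S28** is stated for curves *without geometric CM* only (`¬ (E.baseChange K).HasCM`,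
  accepted prelude `EllArithM.Isogeny`), like the other accepted formulation
  `Lang.exists_isCMField_isModular` (Sweep1): for `E` with CM by an imaginary quadratic `M ⊆ L`
  the automorphic representation of `E_L` is the Eisenstein (non-cuspidal) `ψ ⊞ ψ^c`, and no
  *cuspidal* `π` matches `a_w(E)` (Jacquet–Shalika), so the unrestricted statement is false
  (review of attempt 1; the outline text has the same flaw). Excluding only `K`-rational CM
  (`HasRationalCM`) should also suffice (for CM by `M ⊄ K` the representation of `E_K` is the
  cuspidal automorphic induction of a Hecke character of `KM`); we keep the hypothesis of Sweep1
  for uniformity.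
* The conjecture `FontaineMazurLanglandsGLn 𝔅 n` takes the family of de Rham period-ring data
  `𝔅 K ℓ : DeRhamData K ℓ` (intended: `B_dR(K_v)`, `v ∣ ℓ`) as a parameter instead of
  quantifying over all abstract data (for degenerate data the genuine `r_{π,ι}` need not be
  admissible, which would falsify the automorphic-to-Galois direction).
* Coefficient fields: a continuous `r : Γ_K → GL_n(ℚ̄_ℓ)` has a model over a finite `E/ℚ_ℓ`
  (`exists_hasQlModel`, Baire); Fontaine's theory is `ℚ_ℓ`-linear (G09 `PAdicHodge`, design note
  "Coefficients"), whence `restrictScalarsQl`. The topology on `Fin n → E` is the product of the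
  subspace topology of `E ⊆ ℚ̄_ℓ`, which is the `ℚ_ℓ`-module topology for finite `E/ℚ_ℓ`; in any
  case `IsGeometric` only reads the underlying representation (G09).
* `IsCMField`, `IsTotallyReal`, `PadicAlgCl`, `WeierstrassCurve.map/baseChange`,
  `WeierstrassCurve.Affine.Point`, `Ideal.Quotient.mk`, `Nat.card`, `IntermediateField`,
  `LinearMap.restrictScalars`, `Filter.cofinite`, `Algebra (𝓞 K) (𝓞 L)`
  (`NumberField.inst_ringOfIntegersAlgebra`) are Mathlib's; `WeierstrassCurve.HasCM` is the
  accepted prelude `EllArithM.Isogeny`. Mathlib has no automorphic Galois representations and no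
  reciprocity statement (grep `Reciprocity`, `FontaineMazur`, `potentially modular`: nothing
  relevant).
* Lint debt (review of attempt 1): `restrictScalarsQl` carries the product/subspace topology on
  `Fin n → E` rather than registering `IsModuleTopology ℚ_[ℓ] _` (G09 `PAdicHodge`, D1); sound
  because `E/ℚ_ℓ` is finite in every use and `IsGeometric` only reads the underlying
  representation. `hasSatakeParamAt_ne_zero` is a general fact about `AutomorphicRepData` placed
  here provisionally; it belongs next to `hasSatakeParamAt_unique` in
  `Prelude/AutomorphicL/AutomorphicRepsGL.lean`.
* Hygiene (OUTLINE §0): H5 (`open scoped Classical`); no normed matrices (H3), no `ContDiff` (H4)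
  and no Lie subalgebras (so no `LieRing.ofAssociativeRing` local instance, H1) occur here.
* Universes: `CuspidalAutomorphicRepData n K hcpt` requires `K : Type`; the conjectures quantify
  over `K : Type` and period-ring data with period rings in `Type`.

## M5 migration note (D-0014)

`AutomorphyDatum.gl n K hcpt` and `CuspidalAutomorphicRepData n K hcpt` now take the named fact
`hcpt : isCompact_glFiniteIntegralLevel n K` (`GLnAdelicStructure`) as an explicit parameter
(see the migration note of `AutomorphicRepsGL`). It is threaded here as `∀ hcpt` in **lang.S27**
and **lang.S03**, implicitly (`{hcpt}`, read off the type of `π`) in `hasSatakeParamAt_ne_zero`,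
and as `∃ hL` (a true Prop, so harmless) inside the existential of **lang.S28**. The formerly
sorried statements are named facts `def … : Prop`. The Hasse bound for `frobTraceAt`,
`abs_frobTraceAt_le (h : Literature.NumberTheory.LFunctions.hasse_bound)` (deduced from the accepted
named fact of `LFunctions/RHWave0`, inventory id rh.S36; no third copy of Hasse is introduced), lives
in the sibling proofs file `ReciprocityGLnHasseProofs` (librarian refactor 2026-08-15: this file no
longer imports `LFunctions.RHWave0`, so that the RH-family statements stay out of the import cone
of the summit `Langlands`; `import Mathlib` keeps the environment of the importers unchanged).

## References

* M. Harris, K.-W. Lan, R. Taylor, J. Thorne, *On the rigid cohomology of certain Shimura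
  varieties*, Res. Math. Sci. 3 (2016), Thm. A. [HarrisLanTaylorThorneRMS2016]
* P. Scholze, *On torsion in the cohomology of locally symmetric varieties*, Ann. of Math. 182
  (2015), Thm. 1.0.4, Cor. V.4.2.
* I. Varma, *Local-global compatibility for regular algebraic cuspidal automorphic
  representations when `ℓ ≠ p`*, Forum Math. Sigma 12 (2024) (compatibility at every `v ∤ ℓ`).
  [VarmaFMS2024]
* L. Clozel, *Motifs et formes automorphes* (1990), Conj. 4.5; K. Buzzard, T. Gee, *The
  conjectural connections between automorphic representations and Galois representations*,
  LMS Lecture Note Ser. 414 (2014), Conj. 3.2.1, 3.2.2, 5.3.4. [BuzzardGeeLMS2014]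
* J.-M. Fontaine, B. Mazur, *Geometric Galois representations* (1995), Conj. 1.
  [FontaineMazurGeometric1995]
* P. Allen, F. Calegari, A. Caraiani, T. Gee, D. Helm, B. Le Hung, J. Newton, P. Scholze,
  R. Taylor, J. Thorne, *Potential automorphy over CM fields*, Ann. of Math. 197 (2023),
  Thm. 1.0.1. [ACCGHLNSTT2023]
* P. Cartier, *Representations of 𝔭-adic groups: a survey*, Corvallis 1979, §IV.
  [CartierCorvallis1979]
* J. H. Silverman, *The Arithmetic of Elliptic Curves*, 2nd ed. (2009), Thm. V.1.1.
  [SilvermanAEC2009]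
-/

open scoped MatrixGroups Matrix Classical Polynomial NumberField
open NumberField IsDedekindDomain Field Polynomial Literature.NumberTheory.Automorphic

noncomputable section

namespace Literature.NumberTheory.Automorphic

/-! ## Point counts of reductions of an integral Weierstrass model -/

universe u

section PointCounts

variable {K : Type u} [Field K] [NumberField K]

/-- The number of points `#E(k_v)` of the reduction modulo the finite place `v` of an integral
Weierstrass model `E` over `𝓞 K` (Mathlib `WeierstrassCurve.map` along
`𝓞 K → 𝓞 K ⧸ v = k_v`), counted with the point at infinity (`WeierstrassCurve.Affine.Point.zero`);
`Nat.card` of a finite type (the residue field is finite). Meaningful at places of good reduction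
for `E`. Silverman, *The Arithmetic of Elliptic Curves*, V §1–2, VII §2 (reduction modulo `v`);
pattern of the accepted `Literature.NumberTheory.EllipticCurves.hasse_bound`. [folklore] -/
def numPointsResidue (E : WeierstrassCurve (𝓞 K)) (v : HeightOneSpectrum (𝓞 K)) : ℕ :=
  Nat.card (E.map (Ideal.Quotient.mk v.asIdeal)).toAffine.Point

/-- The **trace of Frobenius** `a_v(E) = q_v + 1 - #E(k_v)` of the integral Weierstrass model `E`
at the finite place `v` (`q_v = v.residueCard`), as an integer. At a place of good reduction this
is the trace of the arithmetic (equivalently geometric) Frobenius on `T_ℓ E`, `ℓ ∤ v`.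
Silverman, *The Arithmetic of Elliptic Curves*, V Thm. 2.3.1, C §16. [folklore] -/
def frobTraceAt (E : WeierstrassCurve (𝓞 K)) (v : HeightOneSpectrum (𝓞 K)) : ℤ :=
  (v.residueCard : ℤ) + 1 - (numPointsResidue E v : ℤ)

end PointCounts

/-! ## Models over finite extensions of `ℚ_ℓ` and restriction of scalars -/

section Models

variable {K : Type u} [Field K] {ℓ : ℕ} [Fact ℓ.Prime] {n : ℕ}

/-- `r : Γ_K → GL_n(ℚ̄_ℓ)` **has the model `rE` over `E`**, `ℚ_ℓ ⊆ E ⊆ ℚ̄_ℓ` an intermediate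
field: `r` is conjugate (`FramedRep.conj`, change of frame) to the extension of scalars
`FramedRep.baseChange` of `rE : Γ_K → GL_n(E)` along the (continuous) inclusion `E ⊆ ℚ̄_ℓ`.
Buzzard–Gee 2014, §2.2 and footnote to Conj. 3.2.1 (every continuous `r` has such a model with
`E/ℚ_ℓ` finite, `exists_hasQlModel`). [cite: BuzzardGeeLMS2014, §2.2] -/
def HasQlModel (r : GaloisRepresentations.FramedGaloisRep K (PadicAlgCl ℓ) n)
    (E : IntermediateField ℚ_[ℓ] (PadicAlgCl ℓ)) (rE : GaloisRepresentations.FramedGaloisRep K E n) : Prop :=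
  ∃ P : GL (Fin n) (PadicAlgCl ℓ),
    GaloisRepresentations.FramedRep.conj P (rE.baseChange (algebraMap E (PadicAlgCl ℓ)) continuous_subtype_val) = r

/-- The **`ℚ_ℓ`-linear Galois representation underlying** `rE : Γ_K → GL_n(E)`: the continuous
representation `rE.toGaloisRep` on `Fin n → E` with scalars restricted from `E` to `ℚ_ℓ`
(Mathlib `LinearMap.restrictScalars`; same maps, same topology — the product of the subspace
topology of `E ⊆ ℚ̄_ℓ`, which is the `ℚ_ℓ`-module topology when `E/ℚ_ℓ` is finite; lint debt:
`IsModuleTopology` is not registered, see the module docstring). Fontaine's period-ring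
formalism and G09's `IsGeometric` are `ℚ_ℓ`-linear. Fontaine, Astérisque 223 (1994),
Exposé III §1; Buzzard–Gee 2014, §2.2. [cite: BuzzardGeeLMS2014, §2.2] -/
def restrictScalarsQl (E : IntermediateField ℚ_[ℓ] (PadicAlgCl ℓ)) (rE : GaloisRepresentations.FramedGaloisRep K E n) :
    GaloisRepresentations.GaloisRep K ℚ_[ℓ] (Fin n → E) where
  toRepresentation :=
    { toFun := fun σ ↦ (rE.toGaloisRep σ).restrictScalars ℚ_[ℓ]
      map_one' := LinearMap.ext fun x ↦ by simp
      map_mul' := fun σ τ ↦ LinearMap.ext fun x ↦ by simp }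
  continuous_smul := rE.toGaloisRep.continuous_smul

/-- Unfolding lemma for `restrictScalarsQl`: the underlying maps are those of `rE.toGaloisRep`. [folklore] -/
@[simp] lemma restrictScalarsQl_apply_apply (E : IntermediateField ℚ_[ℓ] (PadicAlgCl ℓ))
    (rE : GaloisRepresentations.FramedGaloisRep K E n) (σ : absoluteGaloisGroup K) (x : Fin n → E) :
    restrictScalarsQl E rE σ x = rE.toGaloisRep σ x := rfl

/-- **Every continuous `r : Γ_K → GL_n(ℚ̄_ℓ)` is defined over a finite extension of `ℚ_ℓ`**:
`Γ_K` is compact, `ℚ̄_ℓ = ⋃ E` over finite `E/ℚ_ℓ` (countably many), and by Baire's theorem the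
closed subgroup `r⁻¹(GL_n(E))` is open for some `E`, hence of finite index; enlarging `E`
finitely gives `r(Γ_K) ⊆ GL_n(E)`. Buzzard–Gee 2014, footnote to Conj. 3.2.1; Skinner, *A note
on the `p`-adic Galois representations attached to Hilbert modular forms*, Doc. Math. 14 (2009),
§2 (Lemma). Named fact (D-0014), universe-polymorphic in the field `K`.
[cite: BuzzardGeeLMS2014, footnote to Conj. 3.2.1] -/
def exists_hasQlModel : Prop :=
  ∀ {K : Type u} [Field K] {ℓ : ℕ} [Fact ℓ.Prime] {n : ℕ} (r : GaloisRepresentations.FramedGaloisRep K (PadicAlgCl ℓ) n),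
    ∃ (E : IntermediateField ℚ_[ℓ] (PadicAlgCl ℓ)) (rE : GaloisRepresentations.FramedGaloisRep K E n),
      FiniteDimensional ℚ_[ℓ] E ∧ HasQlModel r E rE

end Models

/-! ## The predicted characteristic polynomial of arithmetic Frobenius -/

section FrobPoly

variable {ℓ : ℕ} [Fact ℓ.Prime]

/-- The **characteristic polynomial of arithmetic Frobenius predicted by a Satake parameter**:
for `ι : ℚ̄_ℓ ≃+* ℂ`, a residue cardinality `q`, a shift parameter `m` and a multiset `α` of
complex numbers, `∏_{a ∈ α} (X - ι⁻¹((q^{(m-1)/2} a)⁻¹)) ∈ ℚ̄_ℓ[X]`. With `m = n` and `α` the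
Satake parameter of `π_v` (unitary normalisation, G19) the numbers `q^{(n-1)/2} α_j` are the
roots of the Harris–Lan–Taylor–Thorne Hecke polynomial, i.e. the eigenvalues of the *geometric*
Frobenius on `r_{ℓ,ι}(π)`; their inverses are the eigenvalues of the *arithmetic* Frobenius used
by G09's `HasFrobCharpolyAt` (review 13). With `m = 1` (no half-twist) this is Buzzard–Gee's
normalisation for L-algebraic `π`. `q^{(m-1)/2}` is `(√q)^{m-1}` (`Real.sqrt`, `ℕ`-subtraction
harmless: `m ≥ 1` in every use). Junk: `a = 0` contributes the root `0` (`0⁻¹ = 0`); Satake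
parameters are non-zero (`hasSatakeParamAt_ne_zero`). Harris–Lan–Taylor–Thorne 2016, Thm. A;
Buzzard–Gee 2014, §2.1, Conj. 3.2.1. [cite: HarrisLanTaylorThorneRMS2016, Thm. A] -/
def arithFrobPolyOfSatake (ι : PadicAlgCl ℓ ≃+* ℂ) (q : ℕ) (m : ℕ) (α : Multiset ℂ) :
    Polynomial (PadicAlgCl ℓ) :=
  (α.map fun a ↦ X - C (ι.symm (((Real.sqrt q : ℝ) : ℂ) ^ (m - 1) * a)⁻¹)).prod

/-- `arithFrobPolyOfSatake ι q m α` is monic of degree `card α`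
(Mathlib `Polynomial.natDegree_multiset_prod_X_sub_C_eq_card`). [folklore] -/
theorem natDegree_arithFrobPolyOfSatake (ι : PadicAlgCl ℓ ≃+* ℂ) (q m : ℕ) (α : Multiset ℂ) :
    (arithFrobPolyOfSatake ι q m α).natDegree = Multiset.card α := by
  have h := Polynomial.natDegree_multiset_prod_X_sub_C_eq_card
    (α.map fun a ↦ ι.symm (((Real.sqrt q : ℝ) : ℂ) ^ (m - 1) * a)⁻¹)
  rwa [Multiset.map_map, Multiset.card_map] at h

/-- The roots of `arithFrobPolyOfSatake ι q m α` are the `ι⁻¹((q^{(m-1)/2} a)⁻¹)`, `a ∈ α`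
(Mathlib `Polynomial.roots_multiset_prod_X_sub_C`). [folklore] -/
theorem roots_arithFrobPolyOfSatake (ι : PadicAlgCl ℓ ≃+* ℂ) (q m : ℕ) (α : Multiset ℂ) :
    (arithFrobPolyOfSatake ι q m α).roots =
      α.map fun a ↦ ι.symm (((Real.sqrt q : ℝ) : ℂ) ^ (m - 1) * a)⁻¹ := by
  have h := Polynomial.roots_multiset_prod_X_sub_C
    (α.map fun a ↦ ι.symm (((Real.sqrt q : ℝ) : ℂ) ^ (m - 1) * a)⁻¹)
  rwa [Multiset.map_map] at h

/-- With `m = 1` (L-normalisation) the roots are the `ι⁻¹(a⁻¹)`. Buzzard–Gee 2014, §2.1. [cite: BuzzardGeeLMS2014, §2.1] -/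
theorem arithFrobPolyOfSatake_one (ι : PadicAlgCl ℓ ≃+* ℂ) (q : ℕ) (α : Multiset ℂ) :
    arithFrobPolyOfSatake ι q 1 α = (α.map fun a ↦ X - C (ι.symm a⁻¹)).prod := by
  simp [arithFrobPolyOfSatake]

/-- **Satake parameters of automorphic representations are non-zero**: if `π = W / W'` has
Satake parameter `α` at `v` then `0 ∉ α`, since `e_n(α) = ∏ α_j` is the eigenvalue of the Hecke
operator of `t_{v,n} = ϖ · 1`, which is right translation by a central element and hence
invertible on `W / W'` (cf. G19 `IsSatakeParameter.forall_ne_zero`). Placed here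
provisionally (it belongs in `Automorphic/AutomorphicRepsGL.lean`, next to
`hasSatakeParamAt_unique`). Named fact (D-0014); `hcpt` is read off the type of `π`.
Cartier, Corvallis 1979, §IV.2; Shimura, *Introduction to the arithmetic theory of automorphic
functions*, Thm. 3.21. [cite: CartierCorvallis1979, §IV.2] -/
def hasSatakeParamAt_ne_zero : Prop :=
  ∀ {n : ℕ} {K : Type} [Field K] [NumberField K] {hcpt : isCompact_glFiniteIntegralLevel n K}
    {π : AutomorphicRepData (AutomorphyDatum.gl n K hcpt)}
    {v : HeightOneSpectrum (𝓞 K)} {α : Multiset ℂ}, π.HasSatakeParamAt v α → ∀ a ∈ α, a ≠ 0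

end FrobPoly

/-! ## Period-ring data for the Fontaine–Mazur condition -/

section DeRham

/-- **de Rham period-ring data** for the number field `K` at the prime `ℓ`: for every finite place
`v ∣ ℓ`, a `ℚ_ℓ`-algebra structure on `K_v = v.adicCompletion K` (absent from Mathlib) and a G09
period-ring datum for `Γ_{K_v}` over `ℚ_ℓ` with invariants `K_v` — the argument type of G09's
`GaloisRep.IsGeometric`, intended to be instantiated with Fontaine's `B_dR(K_v)`. The conjectures
below take a family of such data as a **parameter** (rather than quantifying over all abstract
data, for which geometricity of the genuine `r_{π,ι}` would be false). Fontaine, Astérisque 223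
(1994), Exposé II §1.5, III §1; Fontaine–Mazur 1995, §1. [cite: FontaineMazurGeometric1995, §1] -/
abbrev DeRhamData (K : Type) [Field K] [NumberField K] (ℓ : ℕ) [Fact ℓ.Prime] : Type 1 :=
  ∀ v : HeightOneSpectrum (𝓞 K), ((ℓ : ℕ) : 𝓞 K) ∈ v.asIdeal →
    Σ' (_ : Algebra ℚ_[ℓ] (v.adicCompletion K)),
      GaloisRepresentations.PeriodRingData.{0, 0, 0, 0} (absoluteGaloisGroup (v.adicCompletion K)) ℚ_[ℓ]
        (v.adicCompletion K)

end DeRham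

/-! ## lang.S27: Galois representations for regular algebraic `π` (HLTT, Scholze) -/

section Statements

/-- **lang.S27** (Harris–Lan–Taylor–Thorne, Res. Math. Sci. 3 (2016), Thm. A; Scholze, Ann. of
Math. 182 (2015), Thm. 1.0.4 / Cor. V.4.2 — as printed these give the compatibility below away
from `ℓ` and the finitely many rational primes above which `K` or `π` ramify; compatibility at
*every* `v ∤ ℓ`, in particular at every unramified `v ∤ ℓ` as stated here, is Varma, Forum Math.
Sigma 12 (2024), Thm. 1). Let `K` be totally real or CM and `π` a regular algebraic cuspidal
automorphic representation of `GL_n(𝔸_K)`. For every prime `ℓ` and `ι : ℚ̄_ℓ ≃+* ℂ` there is a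
continuous semisimple `r = r_{ℓ,ι}(π) : Γ_K → GL_n(ℚ̄_ℓ)` such that at every finite place
`v ∤ ℓ` where `π` is unramified with Satake parameter `α`, `r` is unramified and the
characteristic polynomial of the arithmetic Frobenius is `∏_j (X - ι⁻¹((q_v^{(n-1)/2} α_j)⁻¹))`
(equivalently: geometric Frobenius has characteristic polynomial `ι⁻¹` of the Hecke polynomial
`∏_j (X - q_v^{(n-1)/2} α_j)`, `r|_{W_v}^{ss} = ι⁻¹ rec(π_v ⊗ |det|^{(1-n)/2})`; review 13).
Compatibility at ramified `v ∤ ℓ` (Varma) and at `v ∣ ℓ` is omitted (module docstring).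
Named fact (D-0014), `∀ hcpt`.
[cite: HarrisLanTaylorThorneRMS2016, Thm. A] [cite: VarmaFMS2024, Thm. 1 (main theorem)] -/
def exists_galoisRep_of_regularAlgebraic : Prop :=
  ∀ {n : ℕ} {K : Type} [Field K] [NumberField K] (hcpt : isCompact_glFiniteIntegralLevel n K),
    IsTotallyReal K ∨ IsCMField K →
    ∀ (π : CuspidalAutomorphicRepData n K hcpt), π.1.IsRegularAlgebraic → ∀ (ℓ : ℕ) [Fact ℓ.Prime]
      (ι : PadicAlgCl ℓ ≃+* ℂ),
      ∃ r : GaloisRepresentations.FramedGaloisRep K (PadicAlgCl ℓ) n, r.toGaloisRep.IsSemisimple ∧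
        ∀ (v : HeightOneSpectrum (𝓞 K)) (α : Multiset ℂ), π.1.HasSatakeParamAt v α →
          ((ℓ : ℕ) : 𝓞 K) ∉ v.asIdeal →
            r.IsUnramifiedAt v ∧
              r.HasFrobCharpolyAt v (arithFrobPolyOfSatake ι v.residueCard n α)

/-! ## lang.S03: the Fontaine–Mazur–Langlands conjecture for `GL_n` -/

/-- **lang.S03** (Fontaine–Mazur–Langlands for `GL_n`; Fontaine–Mazur 1995, Conj. 1 with
Langlands; Buzzard–Gee 2014, Conj. 3.2.2), relative to de Rham period-ring data `𝔅` (intended: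
`B_dR`). Every continuous **irreducible** `r : Γ_K → GL_n(ℚ̄_ℓ)` (`K` a number field) which is
geometric — it has a model `rE` over a finite `E/ℚ_ℓ` (automatic, `exists_hasQlModel`) whose
underlying `ℚ_ℓ`-linear representation is unramified almost everywhere and de Rham at `v ∣ ℓ` — is
automorphic: there is an L-algebraic cuspidal automorphic representation `π` of `GL_n(𝔸_K)` such
that at all but finitely many finite places `v`, `π` is unramified with Satake parameter `α`, `r`
is unramified, and the arithmetic Frobenius has characteristic polynomial `∏_j (X - ι⁻¹(α_j⁻¹))`
(the almost-everywhere form of `r ≅ r_{π,ι}`, equivalent to it for irreducible `r` by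
Chebotarev and Brauer–Nesbitt; `π` is then unique by strong multiplicity one). Open. `∀ hcpt`
(D-0014 threading). [cite: FontaineMazurGeometric1995, Conj. 1 (with Langlands' conjecture)]
[cite: BuzzardGeeLMS2014, Conj. 3.2.2] -/
def FontaineMazurLanglandsGLn
    (𝔅 : ∀ (K : Type) [Field K] [NumberField K] (ℓ : ℕ) [Fact ℓ.Prime], DeRhamData K ℓ)
    (n : ℕ) : Prop :=
  ∀ (K : Type) [Field K] [NumberField K] (hcpt : isCompact_glFiniteIntegralLevel n K)
    (ℓ : ℕ) [Fact ℓ.Prime] (ι : PadicAlgCl ℓ ≃+* ℂ)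
    (E : IntermediateField ℚ_[ℓ] (PadicAlgCl ℓ)) [FiniteDimensional ℚ_[ℓ] E]
    (rE : GaloisRepresentations.FramedGaloisRep K E n) (r : GaloisRepresentations.FramedGaloisRep K (PadicAlgCl ℓ) n),
    HasQlModel r E rE → r.toGaloisRep.IsIrreducible →
      (restrictScalarsQl E rE).IsGeometric (𝔅 K ℓ) →
        ∃ π : CuspidalAutomorphicRepData n K hcpt, π.1.IsLAlgebraic ∧
          ∀ᶠ v : HeightOneSpectrum (𝓞 K) in Filter.cofinite, ∃ α : Multiset ℂ,
            π.1.HasSatakeParamAt v α ∧ r.IsUnramifiedAt v ∧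
              r.HasFrobCharpolyAt v (arithFrobPolyOfSatake ι v.residueCard 1 α)

/-! ## lang.S28: potential modularity of elliptic curves over CM fields -/

/-- **lang.S28** (Allen–Calegari–Caraiani–Gee–Helm–Le Hung–Newton–Scholze–Taylor–Thorne,
*Potential automorphy over CM fields*, Ann. of Math. 197 (2023), Thm. 1.0.1), **partial**:
elliptic curves with geometric CM are excluded (for CM by `M ⊆ L` the automorphic
representation of `E_L` is the non-cuspidal `ψ ⊞ ψ^c`, so the cuspidal conclusion below would be
false; review of attempt 1), and the potential-automorphy-of-`ρ` half of the inventory text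
(ACC+, Thm. 6.1.1) is not covered. Let `K` be a CM field and `E` an elliptic curve over `K`
without geometric CM (`¬ (E.baseChange K).HasCM`, prelude `EllArithM.Isogeny`), given by an
integral Weierstrass model over `𝓞 K` with non-zero discriminant. Then `E` is **potentially
modular**: there is a CM number field `L ⊇ K` and a cuspidal automorphic representation `π` of
`GL_2(𝔸_L)` of weight zero (`HasWeightZero`; in particular regular algebraic,
`AutomorphicRepData.HasWeightZero.isRegularAlgebraic`), such that at all but finitely many finite
places `w` of `L`, `π` is unramified with Satake parameter `α = {α_w, β_w}` and
`q_w^{1/2} (α_w + β_w) = a_w(E_L) = q_w + 1 - #E(k_w)` (`frobTraceAt` of the base-changed model;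
unitary normalisation of the Satake parameter as in G19, so that the `T_w`-eigenvalue is
`q_w^{1/2} e_1(α) = a_w`). See also the other accepted formulation
`Lang.exists_isCMField_isModular` (`H21/Statements/Lang/Sweep1.lean`) of the same id, via
Mathlib's `WeierstrassCurve.localPolynomial`. Named fact (D-0014); the compactness fact
`hL : isCompact_glFiniteIntegralLevel 2 L` needed to *type* `π` is part of the existential (it is
a true Prop, `GLnAdelicStructure`). [cite: ACCGHLNSTT2023, Thm. 1.0.1] -/
def potentiallyModular_ellipticCurve_CM : Prop :=
  ∀ {K : Type} [Field K] [NumberField K] [IsCMField K] (E : WeierstrassCurve (𝓞 K)),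
    E.Δ ≠ 0 → ¬ (E.baseChange K).HasCM →
    ∃ (L : Type) (_ : Field L) (_ : NumberField L) (_ : Algebra K L) (_ : IsCMField L)
      (hL : isCompact_glFiniteIntegralLevel 2 L),
      ∃ π : CuspidalAutomorphicRepData 2 L hL, π.1.HasWeightZero ∧
        ∀ᶠ w : HeightOneSpectrum (𝓞 L) in Filter.cofinite, ∃ α : Multiset ℂ,
          π.1.HasSatakeParamAt w α ∧
            ((Real.sqrt w.residueCard : ℝ) : ℂ) * α.sum =
              (frobTraceAt (E.baseChange (𝓞 L)) w : ℂ)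

end Statements

end Literature.NumberTheory.Automorphic
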